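import Literature.AnabelianGeometry.EtaleTheta.Discharge.Sec1CompatHolds
import HarnessLib

/-!
# [EtTh] §1: elements of `Π^tp_X` over `Δ_Θ` lie in `Δ^tp_Ÿ` — unconditionally

Mochizuki, *The étale theta function …*, Publ. RIMS **45** (2009), §1, PRIMS PDF pp. 12–13, 17, 23
(printed 238–239, 243, 249) [cite: MochizukiEtTh2009, Prop 1.5 (ii) p.23]. Layer L2 of the abc-iut cell,
seat abc-iut-L2-t1 (root owner). PROOF-ONLY consequences of `Discharge/Sec1CompatHolds.lean`
(`ThetaSetting.ker_toEll_le_GtpYN_two`), stated in the shape the §2 adapter consumes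
(abc-iut-L2-t8's `RigidOfSetting.mem_GtpYdd_of_toTheta_mem (hS : D.Sec2Hyps)`), now WITHOUT the
hypothesis structure `Sec2Hyps`: "`Δ_Θ ⊆ (Δ^tp_Ÿ)^Θ ⊆ (Π^tp_Ÿ)^Θ`" (Prop. 1.5 (ii), p. 23) pulled back to
`Π^tp_X` — `Ker(Π^tp_X ↠ (Π^tp_X)^ell) ⊆ Π^tp_Ÿ ∩ Δ^tp_X`, hence `θ⁻¹(Δ_Θ) ⊆ Δ^tp_Ÿ` and
`Ker(Π^tp_X ↠ (Π^tp_X)^Θ) ⊆ Π^tp_Ÿ`. HONEST FRAMING: structural consequences of the root data; nothing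
of [EtTh] is asserted; no side is taken on any disputed claim.
-/

namespace Literature.AnabelianGeometry.EtaleTheta

open Literature.AnabelianGeometry.SemiGraphs

namespace ThetaSetting

variable {p : ℕ} [Fact p.Prime] (D : ThetaSetting p)

/-- **`Ker(Π^tp_X ↠ (Π^tp_X)^ell) ⊆ Π^tp_Ÿ`** (`Π^tp_Ÿ = Π^tp_{Y₂} ∩ aug⁻¹(G_{J̈₁})`, p. 17; the kernel lies in
`Π^tp_{Y₂}` by `ker_toEll_le_GtpYN_two` and in `Δ^tp_X = Ker(aug)`) — for every `ThetaSetting`.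
[cite: MochizukiEtTh2009, Prop 1.5 (ii) p.23] -/
theorem ker_toEll_le_GtpYdd : (D.thetaToEll.comp D.toTheta).ker ≤ D.GtpYdd := by
  intro x hx
  have hΔ : x ∈ D.DeltaTemp := D.ker_toEll_le_deltaTemp hx
  have hone : D.aug.toMonoidHom x = 1 := hΔ
  refine Subgroup.mem_inf.2 ⟨?_, ?_⟩
  · simpa using D.ker_toEll_le_GtpYN_two hx
  · rw [Subgroup.mem_comap, hone]
    exact one_mem _

/-- `Ker(Π^tp_X ↠ (Π^tp_X)^ell) ⊆ Δ^tp_Ÿ = Π^tp_Ÿ ∩ Δ^tp_X`. [cite: MochizukiEtTh2009, Prop 1.5 (ii) p.23] -/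
theorem ker_toEll_le_DtpYddN_one : (D.thetaToEll.comp D.toTheta).ker ≤ D.DtpYddN 1 :=
  le_inf D.ker_toEll_le_GtpYdd D.ker_toEll_le_deltaTemp

/-- `Ker(Π^tp_X ↠ (Π^tp_X)^Θ) ⊆ Π^tp_Ÿ`. [cite: MochizukiEtTh2009, Prop 1.5 (ii) p.23] -/
theorem ker_toTheta_le_GtpYdd : D.toTheta.ker ≤ D.GtpYdd := fun x hx =>
  D.ker_toEll_le_GtpYdd (by
    rw [MonoidHom.mem_ker] at hx
    rw [MonoidHom.mem_ker, MonoidHom.coe_comp, Function.comp_apply, hx, map_one])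

/-- **Elements of `Π^tp_X` whose image in `(Π^tp_X)^Θ` lies in `Δ_Θ` belong to `Δ^tp_Ÿ`** — the shape
used by the §2 adapter (`RigidOfSetting.mem_GtpYdd_of_toTheta_mem`), here for EVERY `ThetaSetting`
(no `Sec2Hyps`). [cite: MochizukiEtTh2009, Prop 2.14 (i) p.49] -/
theorem mem_GtpYdd_of_toTheta_mem_deltaTheta {x : D.PiTemp} (hx : D.toTheta x ∈ D.DeltaTheta) :
    x ∈ D.GtpYdd ∧ x ∈ D.DeltaTemp := by
  have hker : x ∈ (D.thetaToEll.comp D.toTheta).ker := by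
    rw [MonoidHom.mem_ker, MonoidHom.coe_comp, Function.comp_apply]
    exact hx
  exact ⟨D.ker_toEll_le_GtpYdd hker, D.ker_toEll_le_deltaTemp hker⟩

/-- `θ⁻¹(Δ_Θ) = Ker(Π^tp_X ↠ (Π^tp_X)^ell)` lies in `Δ^tp_Ÿ`: the comap form.
[cite: MochizukiEtTh2009, Prop 1.5 (ii) p.23] -/
theorem comap_toTheta_deltaTheta_le_DtpYddN_one :
    D.DeltaTheta.comap D.toTheta ≤ D.DtpYddN 1 := fun _ hx =>
  Subgroup.mem_inf.2 (D.mem_GtpYdd_of_toTheta_mem_deltaTheta (Subgroup.mem_comap.1 hx))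

end ThetaSetting

end Literature.AnabelianGeometry.EtaleTheta
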